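import Summits.Ventures.PercRepro.S1CoreCapAvg
import Summits.Ventures.PercRepro.S1CoreCapSpecFourMain

/-!
# PercRepro — UNCONDITIONAL 4-CIRCUIT BOUNDS FROM THE KERNEL INSTANCES `ν ≤ 4` (p1, gen 23; the s₄ seat)

`proofs/P1-S4-CAPBRIDGE.md` §15. The instances `ν ≤ 4` of the cap spec are kernel theorems, so the per-point bound
`#4circ(e) ≤ Q*(ν)` on a core of nullity `ν ≤ 4` (the bridge) holds with NO computed hypothesis; the star step
(`S1CoreCapSum`) lifts it to `15, 24, 34, 46, …` at `ν = 5, 6, 7, 8, …` (`qKer`), and p3's recursion sums: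
`s₄ ≤ capKer ν = 0, 1, 5, 10, 18, 33, 57, 91, 137, …` — against the previous unconditional table
`fourCircuitBound = 1, 5, 13, 27, 48, 78, 118, 170` (`S1CoreFourCircuitSum`). The averaging recursion of
`S1CoreCapAvg` then gives `s₄ ≤ 85` at `ν = 7` and `s₄ ≤ 122` at `ν = 8`. Every statement here is a theorem of the
tree with standard axioms and no `FourCapSpec` hypothesis (p8's cells `(29, 7)` / `(29, 8)` need `108` / `156`).
-/

open scoped Matroid

namespace PercRepro

namespace S1

open Set

open FourCap

variable {α : Type}

/-- The kernel per-point table: the proved instances `Q*(0..4) = 0, 1, 4, 5, 8`, then the star chain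
`qKer (n + 5) = ⌊3(n + 5)/2⌋ + qKer (n + 4)` (`15, 24, 34, 46, 59, 74, …`). -/
def qKer : ℕ → ℕ
  | 0 => 0
  | 1 => 1
  | 2 => 4
  | 3 => 5
  | 4 => 8
  | n + 5 => 3 * (n + 5) / 2 + qKer (n + 4)

/-- The values `qKer 5 = 15`, `qKer 6 = 24`, `qKer 7 = 34`, `qKer 8 = 46`. -/
theorem qKer_values : qKer 5 = 15 ∧ qKer 6 = 24 ∧ qKer 7 = 34 ∧ qKer 8 = 46 := by decide

/-- **The unconditional per-point bound**: on every core of nullity `j`, `#4circ(e) ≤ qKer j` — the bridge with the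
kernel instances for `j ≤ 4`, the star step beyond. -/
theorem ncard_fourCircuitsThrough_le_qKer : ∀ (j : ℕ) (M : Matroid α) [M.Finite],
    (∀ e ∈ M.E, ∃ A ⊆ M.E \ {e}, e ∉ M.closure A ∧ e ∉ M.closure ((M.E \ {e}) \ A)) →
    M.E.encard = M.eRank + j → ∀ e ∈ M.E,
    {C : Set α | M.IsCircuit C ∧ C.ncard = 4 ∧ e ∈ C}.ncard ≤ qKer j
  | 0, M, _, hfree, hd, _, he => ncard_fourCircuitsThrough_le_of_fourCapSpec M hfree hd he fourCapSpec_zero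
  | 1, M, _, hfree, hd, _, he => ncard_fourCircuitsThrough_le_of_fourCapSpec M hfree hd he fourCapSpec_one
  | 2, M, _, hfree, hd, _, he => ncard_fourCircuitsThrough_le_of_fourCapSpec M hfree hd he fourCapSpec_two
  | 3, M, _, hfree, hd, _, he => ncard_fourCircuitsThrough_le_of_fourCapSpec M hfree hd he fourCapSpec_three
  | 4, M, _, hfree, hd, _, he => ncard_fourCircuitsThrough_le_of_fourCapSpec M hfree hd he fourCapSpec_four
  | n + 5, M, _, hfree, hd, e, _ =>
    ncard_fourCircuitsThrough_le_star_add_of_forall M hfree (m := n + 4) hd e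
      (fun M' _ hfree' hj e' he' => ncard_fourCircuitsThrough_le_qKer (n + 4) M' hfree' hj e' he')

/-- The unconditional table `Σ_{j ≤ d} qKer j` (`= 0, 1, 5, 10, 18, 33, 57, 91, 137` at `d = 0 … 8`). -/
def capKer (d : ℕ) : ℕ := (Finset.range (d + 1)).sum qKer

/-- The values `capKer 5 = 33`, `capKer 6 = 57`, `capKer 7 = 91`, `capKer 8 = 137`. -/
theorem capKer_values : capKer 5 = 33 ∧ capKer 6 = 57 ∧ capKer 7 = 91 ∧ capKer 8 = 137 := by decide

/-- **`s₄ ≤ capKer ν` on every core of nullity `ν`, unconditionally** (p3's recursion on the kernel per-point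
table). -/
theorem ncard_fourCircuits_le_capKer (M : Matroid α) [M.Finite]
    (hfree : ∀ e ∈ M.E, ∃ A ⊆ M.E \ {e}, e ∉ M.closure A ∧ e ∉ M.closure ((M.E \ {e}) \ A))
    {d : ℕ} (hd : M.E.encard = M.eRank + d) :
    {C : Set α | M.IsCircuit C ∧ C.ncard = 4}.ncard ≤ capKer d :=
  FourCircuitCap.ncard_fourCircuits_le_sum_of_perPoint qKer
    (fun M' _ hfree' j hj e he => ncard_fourCircuitsThrough_le_qKer j M' hfree' hj e he) M hfree hd

/-- **`s₄ ≤ 33` on every core of nullity 5**, unconditionally. -/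
theorem ncard_fourCircuits_le_thirty_three_uncond (M : Matroid α) [M.Finite]
    (hfree : ∀ e ∈ M.E, ∃ A ⊆ M.E \ {e}, e ∉ M.closure A ∧ e ∉ M.closure ((M.E \ {e}) \ A))
    (hd : M.E.encard = M.eRank + 5) : {C : Set α | M.IsCircuit C ∧ C.ncard = 4}.ncard ≤ 33 := by
  have h := ncard_fourCircuits_le_capKer M hfree hd
  rwa [capKer_values.1] at h

/-- **`s₄ ≤ 57` on every core of nullity 6**, unconditionally. -/
theorem ncard_fourCircuits_le_fifty_seven_uncond (M : Matroid α) [M.Finite]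
    (hfree : ∀ e ∈ M.E, ∃ A ⊆ M.E \ {e}, e ∉ M.closure A ∧ e ∉ M.closure ((M.E \ {e}) \ A))
    (hd : M.E.encard = M.eRank + 6) : {C : Set α | M.IsCircuit C ∧ C.ncard = 4}.ncard ≤ 57 := by
  have h := ncard_fourCircuits_le_capKer M hfree hd
  rwa [capKer_values.2.1] at h

/-- **`s₄ ≤ 91` on every core of nullity 7**, unconditionally (the plain sum). -/
theorem ncard_fourCircuits_le_ninety_one_uncond (M : Matroid α) [M.Finite]
    (hfree : ∀ e ∈ M.E, ∃ A ⊆ M.E \ {e}, e ∉ M.closure A ∧ e ∉ M.closure ((M.E \ {e}) \ A))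
    (hd : M.E.encard = M.eRank + 7) : {C : Set α | M.IsCircuit C ∧ C.ncard = 4}.ncard ≤ 91 := by
  have h := ncard_fourCircuits_le_capKer M hfree hd
  rwa [capKer_values.2.2.1] at h

/-- **`s₄ ≤ 85` on every core of nullity 7**, unconditionally — the averaging recursion on `s₄(6) ≤ 57`
(`s − ⌊s/3⌋ ≤ 57 ⟹ s ≤ 85`). -/
theorem ncard_fourCircuits_le_eighty_five_uncond (M : Matroid α) [M.Finite]
    (hfree : ∀ e ∈ M.E, ∃ A ⊆ M.E \ {e}, e ∉ M.closure A ∧ e ∉ M.closure ((M.E \ {e}) \ A))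
    (hd : M.E.encard = M.eRank + 7) : {C : Set α | M.IsCircuit C ∧ C.ncard = 4}.ncard ≤ 85 := by
  have h := ncard_fourCircuits_sub_div_le M hfree (d := 6) hd (le_refl 6)
    (fun M' _ hfree' hd' => ncard_fourCircuits_le_fifty_seven_uncond M' hfree' hd')
  omega

/-- **`s₄ ≤ 122` on every core of nullity 8**, unconditionally — the averaging recursion on `s₄(7) ≤ 85`
(`s − ⌊4s/13⌋ ≤ 85 ⟹ s ≤ 122`). -/
theorem ncard_fourCircuits_le_one_twenty_two_uncond (M : Matroid α) [M.Finite]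
    (hfree : ∀ e ∈ M.E, ∃ A ⊆ M.E \ {e}, e ∉ M.closure A ∧ e ∉ M.closure ((M.E \ {e}) \ A))
    (hd : M.E.encard = M.eRank + 8) : {C : Set α | M.IsCircuit C ∧ C.ncard = 4}.ncard ≤ 122 := by
  have h := ncard_fourCircuits_sub_div_le M hfree (d := 7) hd (by omega)
    (fun M' _ hfree' hd' => ncard_fourCircuits_le_eighty_five_uncond M' hfree' hd')
  omega

end S1

end PercRepro
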